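import Literature.Barriers.CriticalPhenomena.SupercriticalSAWSpaceFillingTilesSurgery
import Literature.Barriers.CriticalPhenomena.SupercriticalSAWSpaceFillingTilesAnnulus
import HarnessLib

/-!
# Supercritical SAW (Duminil-Copin–Kozma–Yadin 2014), Theorem 6 for the disk via odd tiles:
# the pieces of the Peierls sum and the covering of the hole event

Penultimate file of the tile form of the proof of Theorem 6 of H. Duminil-Copin, G. Kozma,
A. Yadin, *Supercritical self-avoiding walks are space-filling*, Ann. IHP Probab. Stat. 50
(2014), §3, for `Ω = 𝔻`. With the parameters `ρ = 3L + 2A + 12`, `Rd = ρ + 6`,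
`K = Rd + h + 1`, `ξ = ρ + 2K + 2h + 1`:

* `lawAt_mainPiece_le` — the law of the walks whose support lies in the main event of
  `(𝒞, t', d₀)` is at most `80(ρ+1) max(1,x⁻¹)^{10ρ+3} / (x^{(4r+2)(N-1)} Z_m(x)^N)`
  (`mainEvent_bound` and the transfer `lawAt_le_of_list_bound`; the endpoints are far from the
  deep tile `t'` because they are near the outside, `l1dist_gt_of_nearOutside`).
* `lawAt_annPiece_le` — the same for the annular event of `(d₀, G)` with the half-disk family.
* `hasLargeHole_subset` — **the covering**: every walk with `HasLargeHole ξ s γ` lies in one of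
  the main pieces indexed by `t' ∈ deepTiles`, a direction, `N ≥ ⌊s/C₃⌋ + 1`, a connected family
  `𝒞 ∋ t' + dp` of `N` deep tiles avoiding `t'`, and `d₀ ∈ (ρ - L, ρ]`, or in one of the
  annular pieces indexed by `d₀ ∈ [ρ + 1, 2⌈1/δ⌉]` and one of the eight frames at the origin
  (`exists_clear_family_or_annulus` and the choice `d₀ = dist_{ℓ¹}`).
-/

noncomputable section

open MeasureTheory Finset Literature.Probability.LatticeModels Literature.Probability.Percolation
  Literature.Probability.RandomPlanarGeometry.SAW
open scoped ENNReal

namespace Literature.Barriers.CriticalPhenomena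

namespace SupercriticalSAW

variable {m r : ℕ} {δ : ℝ} {u v : Site 2}

/-! ### The parameters -/

/-- The clearance radius `ρ = 3L + 2A + 12` (project parameter; the print works with box-distance
`1` and the tube radius `6m`). [folklore] -/
def rhoP (m r : ℕ) : ℕ := 3 * OddTile.side m r + 2 * (OddTile.hw m r + r) + 12

/-- The depth radius `Rd = ρ + 6`. [folklore] -/
def RdP (m r : ℕ) : ℕ := rhoP m r + 6

/-- The push `K = Rd + h + 1`. [folklore] -/
def KP (m r : ℕ) : ℕ := RdP m r + OddTile.hw m r + 1

/-- The tube radius `ξ = ρ + 2K + 2h + 1`. [cite: DuminilCopinKozmaYadin2014, Theorem 6 (Γ_δ^{6m})] -/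
def xiP (m r : ℕ) : ℕ := rhoP m r + 2 * KP m r + 2 * OddTile.hw m r + 1

/-- The fibre constant `C₃ = (2(K+h)+1)²` of the hole tile map. [folklore] -/
def C3P (m r : ℕ) : ℕ := (2 * (KP m r + OddTile.hw m r) + 1) ^ 2

/-- Basic inequalities between the parameters. [folklore] -/
theorem params_bounds (m r : ℕ) :
    2 * Splice.A m r + 12 + OddTile.side m r ≤ (rhoP m r : ℤ) + 1 ∧ 3 * (OddTile.side m r : ℤ) ≤ rhoP m r ∧
      (rhoP m r : ℤ) + 6 = RdP m r ∧ 2 * (OddTile.hw m r : ℤ) ≤ rhoP m r ∧ Splice.A m r + 1 ≤ (RdP m r : ℤ) := by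
  have hA : Splice.A m r = OddTile.hw m r + r := rfl
  have hs := OddTile.side_eq (m := m) (r := r)
  simp only [rhoP, RdP, hA]; push_cast; omega

/-! ### Endpoints near the outside are far from deep tiles -/

/-- A site near the outside of `𝔻_δ` is at `ℓ¹`-distance `> Rd - 5` from the centre of a deep
tile. [folklore] -/
theorem l1dist_gt_of_nearOutside {Rd : ℕ} {t' : Site 2} (ht' : IsDeepTile δ m r Rd t') (hu : NearOutside δ u) :
    (Rd : ℤ) - 5 < l1dist u (OddTile.ctr m r t') := by
  obtain ⟨w, hw, hnear⟩ := hu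
  by_contra hcon
  push Not at hcon
  refine hw (ht' w fun i => ?_)
  have hi := hnear i
  simp only [l1dist] at hcon
  have hui : |u i - OddTile.ctr m r t' i| ≤ (Rd : ℤ) - 5 := by
    have a0 := abs_nonneg (u 0 - OddTile.ctr m r t' 0); have a1 := abs_nonneg (u 1 - OddTile.ctr m r t' 1)
    fin_cases i
    · show |u 0 - OddTile.ctr m r t' 0| ≤ (Rd : ℤ) - 5; omega
    · show |u 1 - OddTile.ctr m r t' 1| ≤ (Rd : ℤ) - 5; omega
  have := abs_sub_le (w i) (u i) (OddTile.ctr m r t' i)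
  rw [abs_sub_comm] at hi
  omega

/-! ### The main pieces -/

/-- The per-piece bound of the main case for families of `N` tiles:
`80(ρ+1) max(1,x⁻¹)^{10ρ+3} / (x^{(4r+2)(N-1)} Z_m(x)^N)`. [folklore] -/
def bMain (m r : ℕ) (x : ℝ) (N : ℕ) : ℝ :=
  80 * ((rhoP m r : ℝ) + 1) * max 1 x⁻¹ ^ (10 * rhoP m r + 3) / (x ^ ((4 * r + 2) * (N - 1)) * Zbox m x ^ N)

/-- **The law of a main piece.** [cite: DuminilCopinKozmaYadin2014, Proposition 7] -/
theorem lawAt_mainPiece_le (hδ : 0 < δ) (hδ4 : δ ≤ 1 / 4) (hr : 4 ≤ r) {x : ℝ} (hx : 0 < x) (hZ : 0 < Zbox m x)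
    {a b : ℂ} (ha : ‖a‖ = 1) (hb : ‖b‖ = 1) (hu : IsClosestSite unitDisk δ a u) (hv : IsClosestSite unitDisk δ b v)
    (huv : 10 ≤ l1dist u v) {𝒞 : Finset (Site 2)} {t' : Site 2} {dp : Dir} {d₀ : ℤ}
    (h𝒞 : 𝒞 ⊆ deepTiles δ m r (RdP m r)) (h𝒞conn : IsGraphConnected (zdGraph 2) 𝒞) (ht' : t' ∉ 𝒞)
    (ht'deep : IsDeepTile δ m r (RdP m r) t') (ht : t' + dp.vec ∈ 𝒞)
    (hd₀ : (rhoP m r : ℤ) - OddTile.side m r + 1 ≤ d₀ ∧ d₀ ≤ rhoP m r) :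
    lawAt x unitDisk δ u v {γ | γ.walk.support ∈ mainEvent m r δ u v (rhoP m r) 𝒞 t' d₀} ≤
      ENNReal.ofReal (bMain m r x 𝒞.card) := by
  obtain ⟨p1, p2, p3, p4, p5⟩ := params_bounds m r
  have hfar : ∀ {w : Site 2} {c : ℂ}, ‖c‖ = 1 → IsClosestSite unitDisk δ c w → d₀ < l1dist w (OddTile.ctr m r t') :=
    fun hc hw => by
      have := l1dist_gt_of_nearOutside ht'deep (nearOutside_of_isClosestSite hδ hδ4 hc hw)
      omega
  have key := mainEvent_bound (u := u) (v := v) hδ hr hx (fun τ hτ => (mem_deepTiles hδ).1 (h𝒞 hτ)) h𝒞conn ht' ht'deep ht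
    (by omega) (by omega) hd₀.2 (by omega) huv (hfar ha hu) (hfar hb hv)
  have hden : 0 < x ^ ((4 * r + 2) * (𝒞.card - 1)) * Zbox m x ^ 𝒞.card := by positivity
  have hmax : (1 : ℝ) ≤ max 1 x⁻¹ := le_max_left _ _
  refine lawAt_le_of_list_bound hδ hu.1 hx.le (fun γ hγ => hγ) (by unfold bMain; positivity) ?_
  rw [bMain, div_mul_eq_mul_div, le_div_iff₀ hden]
  refine key.trans ?_
  have hZl : 0 ≤ listPartition (zdGraph 2) (Dfin δ) u v x := Finset.sum_nonneg fun l _ => pow_nonneg hx.le _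
  have h1 : (80 : ℝ) * (d₀ + 1) ≤ 80 * ((rhoP m r : ℝ) + 1) := by
    have : (d₀ : ℝ) ≤ rhoP m r := by exact_mod_cast hd₀.2
    linarith
  have h2 : max 1 x⁻¹ ^ (10 * d₀ + 3).toNat ≤ max 1 x⁻¹ ^ (10 * rhoP m r + 3) :=
    pow_le_pow_right₀ hmax (by omega)
  have hd0 : (0 : ℝ) ≤ d₀ := by exact_mod_cast (show (0 : ℤ) ≤ d₀ by omega)
  have h80 : (0 : ℝ) ≤ 80 * (d₀ + 1) := by linarith
  have h3 : 80 * ((d₀ : ℝ) + 1) * max 1 x⁻¹ ^ (10 * d₀ + 3).toNat ≤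
      80 * ((rhoP m r : ℝ) + 1) * max 1 x⁻¹ ^ (10 * rhoP m r + 3) :=
    mul_le_mul h1 h2 (pow_nonneg (zero_le_one.trans hmax) _) (by positivity)
  calc 80 * ((d₀ : ℝ) + 1) * max 1 x⁻¹ ^ (10 * d₀ + 3).toNat * listPartition (zdGraph 2) (Dfin δ) u v x
      ≤ 80 * ((rhoP m r : ℝ) + 1) * max 1 x⁻¹ ^ (10 * rhoP m r + 3) * listPartition (zdGraph 2) (Dfin δ) u v x :=
        mul_le_mul_of_nonneg_right h3 hZl
    _ = _ := by ring

/-! ### The annular pieces -/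

/-- The eight frames at a point. [folklore] -/
def framesAt (z₀ : Site 2) : Finset Frame := by
  classical
  exact {Frame.std z₀, (Frame.std z₀).mirror, (Frame.std z₀).flipY, (Frame.std z₀).mirror.flipY,
    (Frame.std z₀).swap, (Frame.std z₀).mirror.swap, (Frame.std z₀).flipY.swap, (Frame.std z₀).mirror.flipY.swap}

/-- Every frame at `z₀` is one of the eight. [folklore] -/
theorem mem_framesAt {F : Frame} {z₀ : Site 2} (hF : F.z₀ = z₀) : F ∈ framesAt z₀ := by
  classical
  obtain ⟨z, ex, ey, hv⟩ := F
  simp only at hF; subst hF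
  rcases hv with ⟨h1, h2 | h2⟩ | ⟨h1, h2 | h2⟩ | ⟨h1, h2 | h2⟩ | ⟨h1, h2 | h2⟩ <;> subst h1 <;> subst h2 <;>
    simp [framesAt, Frame.std, Frame.mirror, Frame.flipY, Frame.swap, neg_pt, site_eq_iff]

/-- Frames of `framesAt z₀` are centred at `z₀`. [folklore] -/
theorem z₀_of_mem_framesAt {F : Frame} {z₀ : Site 2} (hF : F ∈ framesAt z₀) : F.z₀ = z₀ := by
  classical
  simp only [framesAt, Finset.mem_insert, Finset.mem_singleton] at hF
  rcases hF with h | h | h | h | h | h | h | h <;> rw [h] <;> rfl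

/-- There are at most eight frames at a point. [folklore] -/
theorem card_framesAt_le (z₀ : Site 2) : (framesAt z₀).card ≤ 8 := by
  classical
  unfold framesAt
  refine (Finset.card_insert_le _ _).trans (Nat.succ_le_succ ?_)
  refine (Finset.card_insert_le _ _).trans (Nat.succ_le_succ ?_)
  refine (Finset.card_insert_le _ _).trans (Nat.succ_le_succ ?_)
  refine (Finset.card_insert_le _ _).trans (Nat.succ_le_succ ?_)
  refine (Finset.card_insert_le _ _).trans (Nat.succ_le_succ ?_)
  refine (Finset.card_insert_le _ _).trans (Nat.succ_le_succ ?_)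
  refine (Finset.card_insert_le _ _).trans (Nat.succ_le_succ ?_)
  simp

/-- The per-piece bound of the annular case at radius `d₀` for a family of `N` tiles:
`80(d₀+1) max(1,x⁻¹)^{(10 d₀+3)} / (x^{(4r+2)(N-1)} Z_m(x)^N)`. [folklore] -/
def bAnn (m r : ℕ) (x : ℝ) (d₀ : ℤ) (N : ℕ) : ℝ :=
  80 * ((d₀ : ℝ) + 1) * max 1 x⁻¹ ^ (10 * d₀ + 3).toNat / (x ^ ((4 * r + 2) * (N - 1)) * Zbox m x ^ N)

/-- **The law of an annular piece.** [cite: DuminilCopinKozmaYadin2014, §3 (proof of Theorem 6)] -/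
theorem lawAt_annPiece_le (hδ : 0 < δ) (hδ' : δ ≤ 1 / 10) (hr : 4 ≤ r) {x : ℝ} (hx : 0 < x) (hZ : 0 < Zbox m x)
    {a b : ℂ} (ha : ‖a‖ = 1) (hb : ‖b‖ = 1) (hu : IsClosestSite unitDisk δ a u) (hv : IsClosestSite unitDisk δ b v)
    (huv : 10 ≤ l1dist u v) {M : ℕ} (hM : 1 ≤ M) (hdeepM : ∀ τ : Site 2, (∀ k, |τ k| ≤ M) → IsDeepTile δ m r (RdP m r) τ)
    {d₀ : ℤ} (hd₀ : (rhoP m r : ℤ) + 1 ≤ d₀) {G : Frame} (hG : G.z₀ = 0) :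
    lawAt x unitDisk δ u v {γ | γ.walk.support ∈ annEvent m r δ u v (rhoP m r) (RdP m r) d₀ G} ≤
      ENNReal.ofReal (bAnn m r x d₀ (halfFamily δ m r (RdP m r) G).card) := by
  obtain ⟨p1, p2, p3, p4, p5⟩ := params_bounds m r
  have key := annEvent_bound (u := u) (v := v) (ρ := (rhoP m r : ℤ)) (d₀ := d₀) hδ hδ' hr hx hG hM hdeepM
    (by omega) p4 p5 ha hb hu hv huv
  set N := (halfFamily δ m r (RdP m r) G).card
  have hden : 0 < x ^ ((4 * r + 2) * (N - 1)) * Zbox m x ^ N := by positivity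
  have hd0 : (0 : ℝ) ≤ d₀ := by exact_mod_cast (show (0 : ℤ) ≤ d₀ by omega)
  refine lawAt_le_of_list_bound hδ hu.1 hx.le (fun γ hγ => hγ) (by unfold bAnn; positivity) ?_
  rw [bAnn, div_mul_eq_mul_div, le_div_iff₀ hden]
  exact key

/-! ### The `ℓ¹`-distance from a point to a walk -/

/-- The `ℓ¹`-distance from `z₀` to the (non-empty) list `l`. [folklore] -/
def distTo (z₀ : Site 2) (l : List (Site 2)) (hl : l ≠ []) : ℤ :=
  (l.toFinset.image fun w => l1dist w z₀).min' (by
    obtain ⟨w, hw⟩ := List.exists_mem_of_ne_nil l hl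
    exact ⟨_, Finset.mem_image_of_mem _ (List.mem_toFinset.2 hw)⟩)

/-- The distance is attained and is a lower bound. [folklore] -/
theorem distTo_spec (z₀ : Site 2) (l : List (Site 2)) (hl : l ≠ []) :
    (∀ w ∈ l, distTo z₀ l hl ≤ l1dist w z₀) ∧ ∃ g ∈ l, l1dist g z₀ = distTo z₀ l hl := by
  classical
  constructor
  · intro w hw
    exact Finset.min'_le _ _ (Finset.mem_image_of_mem _ (List.mem_toFinset.2 hw))
  · have hmem := Finset.min'_mem (l.toFinset.image fun w => l1dist w z₀) (by
      obtain ⟨w, hw⟩ := List.exists_mem_of_ne_nil l hl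
      exact ⟨_, Finset.mem_image_of_mem _ (List.mem_toFinset.2 hw)⟩)
    obtain ⟨g, hg, hgeq⟩ := Finset.mem_image.1 hmem
    exact ⟨g, List.mem_toFinset.1 hg, hgeq⟩

/-! ### The covering of the hole event -/

/-- The index bound: sites of `𝔻_δ` have `ℓ¹` norm at most `2⌈1/δ⌉`. [folklore] -/
theorem l1dist_zero_le (hδ : 0 < δ) {w : Site 2} (hw : w ∈ meshDomain unitDisk δ) :
    l1dist w 0 ≤ 2 * (⌈1 / δ⌉₊ : ℕ) := by
  have key : ∀ i, |w i| ≤ (⌈1 / δ⌉₊ : ℕ) := fun i => by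
    have h1 := abs_lt_of_mem_meshDomain_unitDisk hδ hw i
    have hlt : |((w i : ℤ) : ℝ)| < ((⌈1 / δ⌉₊ : ℕ) : ℝ) := h1.trans_le (Nat.le_ceil _)
    have : |w i| < ((⌈1 / δ⌉₊ : ℕ) : ℤ) := by exact_mod_cast hlt
    omega
  have h0 := key 0; have h1 := key 1
  simp only [l1dist, Pi.zero_apply, sub_zero]
  omega

/-- **The covering of the hole event.** See the module docstring. For `0 < δ ≤ min(1, 1/K²)`,
`s ≥ 0`, `u ∈ 𝔻_δ`. [cite: DuminilCopinKozmaYadin2014, §3 (proof of Theorem 6)] -/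
theorem hasLargeHole_subset (hδ : 0 < δ) (hδK : δ ≤ 1 / (KP m r : ℝ) ^ 2) (hu : u ∈ meshDomain unitDisk δ)
    {s : ℝ} (hs : 0 ≤ s) :
    {γ : DomainSAW unitDisk δ u v | HasLargeHole (xiP m r) s γ} ⊆
      (⋃ t' ∈ deepTiles δ m r (RdP m r), ⋃ dp : Dir,
        ⋃ N ∈ Finset.Icc (⌊s / C3P m r⌋₊ + 1) (deepTiles δ m r (RdP m r)).card,
        ⋃ 𝒞 ∈ (famT δ m r (RdP m r) (t' + dp.vec) N).filter (fun 𝒞 => t' ∉ 𝒞),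
        ⋃ d₀ ∈ Finset.Icc ((rhoP m r : ℤ) - OddTile.side m r + 1) (rhoP m r),
          {γ | γ.walk.support ∈ mainEvent m r δ u v (rhoP m r) 𝒞 t' d₀}) ∪
      ⋃ d₀ ∈ Finset.Icc ((rhoP m r : ℤ) + 1) (2 * ⌈1 / δ⌉₊), ⋃ G ∈ framesAt 0,
          {γ | γ.walk.support ∈ annEvent m r δ u v (rhoP m r) (RdP m r) d₀ G} := by
  classical
  intro γ hγ
  simp only [Set.mem_setOf_eq] at hγ
  obtain ⟨p1, p2, p3, p4, p5⟩ := params_bounds m r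
  have hhw := OddTile.hw_eq (m := m) (r := r)
  have hside := OddTile.side_eq (m := m) (r := r)
  set l := γ.walk.support with hl
  have hlne : l ≠ [] := γ.walk.support_ne_nil
  have hlmem : l ∈ domSawLists (zdGraph 2) (Dfin δ) u v := support_mem_domSawLists_Dfin hδ hu γ
  have hlD : ∀ w ∈ l, w ∈ meshDomain unitDisk δ := support_subset_meshDomain γ.walk hu
  have hK : RdP m r + OddTile.hw m r + 1 ≤ KP m r := le_rfl
  have hK2 : 2 ≤ KP m r := by unfold KP; omega
  have hξ : (((rhoP m r : ℤ) + 2 * (KP m r) + 2 * OddTile.hw m r + 1 : ℤ) : ℝ) ≤ (xiP m r : ℝ) := by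
    unfold xiP; push_cast; exact le_rfl
  rcases exists_clear_family_or_annulus (m := m) (r := r) (Rd := RdP m r) (ρ := (rhoP m r : ℤ)) hδ hK hK2 hδK hu hs hξ hγ with
    ⟨𝒞, h𝒞deep, h𝒞conn, h𝒞clear, h𝒞card, t', ht'𝒞, ht'deep, ht'ncl, t, ht𝒞, hadj⟩ | ⟨hall, h0deep⟩
  · -- the main case
    left
    obtain ⟨dp, hdp⟩ := OddTile.exists_dir_of_adj hadj.symm
    set d₀ := distTo (OddTile.ctr m r t') l hlne with hd₀
    obtain ⟨hfree, g, hg, hgd⟩ := distTo_spec (OddTile.ctr m r t') l hlne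
    -- the radius range
    have hd₀le : d₀ ≤ rhoP m r := by
      unfold IsClearTile at ht'ncl
      push Not at ht'ncl
      obtain ⟨g', hg', hle⟩ := ht'ncl
      exact (hfree g' hg').trans hle
    have hd₀ge : (rhoP m r : ℤ) - OddTile.side m r + 1 ≤ d₀ := by
      have h1 := h𝒞clear t ht𝒞 g hg
      have hct : l1dist (OddTile.ctr m r t) (OddTile.ctr m r t') = OddTile.side m r := by
        rw [hdp]
        simp only [l1dist, OddTile.ctr_apply, Pi.add_apply]
        cases dp <;> simp [Dir.vec, pt_apply_zero, pt_apply_one, mul_add]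
      have tri : l1dist g (OddTile.ctr m r t) ≤ l1dist g (OddTile.ctr m r t') + l1dist (OddTile.ctr m r t) (OddTile.ctr m r t') := by
        simp only [l1dist]
        have := abs_sub_le (g 0) (OddTile.ctr m r t' 0) (OddTile.ctr m r t 0)
        have := abs_sub_le (g 1) (OddTile.ctr m r t' 1) (OddTile.ctr m r t 1)
        have := abs_sub_comm (OddTile.ctr m r t' 0) (OddTile.ctr m r t 0)
        have := abs_sub_comm (OddTile.ctr m r t' 1) (OddTile.ctr m r t 1)
        omega
      omega
    -- the size range
    have hN : ⌊s / C3P m r⌋₊ + 1 ≤ 𝒞.card ∧ 𝒞.card ≤ (deepTiles δ m r (RdP m r)).card := by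
      refine ⟨?_, Finset.card_le_card h𝒞deep⟩
      have hC : (0 : ℝ) < C3P m r := by unfold C3P; positivity
      have h1 : s / C3P m r < 𝒞.card := by
        rw [div_lt_iff₀ hC]; unfold C3P; rw [mul_comm]; exact_mod_cast h𝒞card
      exact Nat.succ_le_of_lt ((Nat.floor_lt (div_nonneg hs hC.le)).2 h1)
    simp only [Set.mem_iUnion, Set.mem_setOf_eq, exists_prop]
    refine ⟨t', (mem_deepTiles hδ).2 ht'deep, dp, 𝒞.card, Finset.mem_Icc.2 hN, 𝒞,
      Finset.mem_filter.2 ⟨mem_famT.2 ⟨h𝒞deep, rfl, hdp ▸ ht𝒞, h𝒞conn⟩, ht'𝒞⟩, d₀,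
      Finset.mem_Icc.2 ⟨hd₀ge, hd₀le⟩, ?_⟩
    exact mem_mainEvent.2 ⟨hlmem, h𝒞clear, hfree, g, hg, hgd⟩
  · -- the annular case
    right
    set d₀ := distTo 0 l hlne with hd₀
    obtain ⟨hfree, g, hg, hgd⟩ := distTo_spec 0 l hlne
    have hd₀ge : (rhoP m r : ℤ) + 1 ≤ d₀ := by
      have := hall 0 h0deep g hg
      rw [ctr_zero] at this
      omega
    have hd₀le : d₀ ≤ 2 * (⌈1 / δ⌉₊ : ℕ) := by
      have h1 := l1dist_zero_le hδ (hlD g hg)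
      rw [hgd] at h1
      rw [hd₀]; exact h1
    simp only [Set.mem_iUnion, Set.mem_setOf_eq, exists_prop]
    refine ⟨d₀, Finset.mem_Icc.2 ⟨hd₀ge, by exact_mod_cast hd₀le⟩, Splice.laneFrame (coverTemplate d₀ l),
      mem_framesAt (by rw [Splice.laneFrame_z₀]; exact (coverTemplate_spec d₀ l).1), ?_⟩
    exact mem_annEvent.2 ⟨hlmem, fun τ hτ => hall τ ((mem_deepTiles hδ).1 hτ), hfree, ⟨g, hg, hgd⟩, rfl⟩

end SupercriticalSAW

end Literature.Barriers.CriticalPhenomena
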